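import Literature.MathematicalPhysics.QuantumFieldTheory.Balaban1983to89.B9Thm33GreenL2BoundCubeZd
import Literature.MathematicalPhysics.QuantumFieldTheory.Balaban1983to89.B9Thm31CoercivePrimeCompactZd

/-!
# `Balaban1983to89.B9Thm311PlaqClosedReadingsCubeZd` — [Balaban1985BackgroundPropagators] Thm 3.11 p. 416 ∕ Thm 3.3 (3.42) p. 397–399 ∕ [Balaban1985RegularSpaces] (1.7) p. 77:
# THE COERCIVITY CONSTANT, THE EXISTENCE OF `G_𝔤(U₀)` AND ITS `L²_τ` BOUND READ ON THE CLOSED CLASS (1.7) ON ALL OF `ℤᵈ` — «every plaquette of `ℤᵈ` within `β` of `1`»,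
# the GAUGE-INVARIANT class the Combes–Thomas stations of dag-n06-w2 g4 and this seat's `B9Thm31CoercivePrimeCompactZd` ∕ `B9Eq325QGGQCoerciveCompactZd` quantify over —
# so that all three «obvious» constants of Thm 3.11 and the `n = 0` bound live on ONE class of backgrounds per member

statement-level skeleton of published theorems with citation tags; proofs where landed; nothing here is a claim about the
Yang–Mills mass gap

`[Balaban1985BackgroundPropagators]` ("B9", CMP **99** (1985) 389–434) p. 396 (3.35) (the small-field class), p. 416 Thm 3.11, p. 399 Thm 3.3; `[Balaban1985RegularSpaces]`
("B8", CMP **99**) p. 77 (1.7).  This file is BOOKKEEPING: the box hypothesis `pdevOn(□₀ ± 3) U₀ < α` of `B9Thm311CoerciveCompactZd` ∕ `B9Thm33GreenL2BoundCubeZd` ∕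
dag-n06-b's `B9Thm311PerMemberCubeZdUnconditional` is implied by «every plaquette within `β` of `1`, `β < α`», and the (1.7)-on-`ℤᵈ` membership by `β < (α_Q∕L²)L^{−2m}`
(`B9Thm31CoercivePrimeCompactZd.reg17Univ_of_forall_plaqF_le`).  PDF held: `paper:balaban1985-cmp99-background-propagators` pp. 396–399, 416 (re-read by this seat, 2026-08-28).

CITATION HEADER (lean-in-tree rule).  Cell `pub-ymgap` (YM Track A, D-0062 ∕ D-0149), node N06 = [B9], width seat `pub-ymgap-dag-n06-w4` (g4), CLAIM-7 ∕ INTENT-7.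
Inputs BY NAME: this seat's g4 `B9Thm311CoerciveCompactZd.exists_coercive_and_regularAtH_of_pdevOn_lt_cube`, `B9Thm33GreenL2BoundCubeZd.bondPair_gopZdH_self_le_of_coercive_of_mem`,
`B9Thm31CoercivePrimeCompactZd.{reg17Univ_of_forall_plaqF_le, one_mem_plaqClosed}`, `B7Prop1Local.pdevOn`, `B8Ineq132.plaqF`.

WHAT IS PROVED (kernel, 0 sorry; theorems only — no `def`, `instance`, `notation`).
* §1 `pdevOn_le_of_forall_plaqF_le` (plaquettes uniformly within `β` of `1` ⟹ `pdevOn lo hi U₀ ≤ β` on every box), `pdevOn_lt_of_forall_plaqF_le`.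
* §2 (cube members, genuine `opsAllZd` at `cubeLamBP`, faithful Hermitian tracial `τ`, finite-dimensional nontrivial fibre) ★★★ `exists_package_plaqClosed_cube` — THERE ARE
  `α > 0` AND `c > 0` (member-dependent) such that for every `β < α` and EVERY unitary `U₀` with `‖U₀(∂p) − 1‖ ≤ β` at EVERY plaquette of `ℤᵈ`: (a) `c·⟨A,A⟩_τ ≤ ⟨A, Δ_a(U₀)A⟩_τ`
  on `E_𝔤(□₀)`; (b) `RegularAtH` (`G_𝔤(U₀)` exists); (c) `⟨G_𝔤(U₀)J, G_𝔤(U₀)J⟩_τ ≤ c⁻²⟨J,J⟩_τ` on `E_𝔤(□₀)`; (d) the member's class (1.7) at window `α_Q∕L²`;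
  ★★ `exists_package_plaqClosed_reg17Univ_cube` (with `β` also below `(α_Q∕L²)L^{−2m}`: (a)–(c) AND membership in the regime `𝒰′` on all of `ℤᵈ` — the class of the
  Combes–Thomas stations); `package_one_cube` (A6 at `U₀ = 1`).

HONEST SCOPE.  Bookkeeping over landed theorems; `α, c` MEMBER-DEPENDENT and NON-QUANTITATIVE; no decay; `τ` a PARAMETER; count-neutral helper (`--supports` the K1 item of
record); N05 ∕ N06 NOT discharged; K1 NOT closed; one finite `𝕋⁴` programme at fixed `ε`, Bałaban as printed; R4 closes only the conditional finite-`𝕋⁴` rung `BalabanLadder.UV`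
— nothing continuum ∕ ℝ⁴ ∕ OS ∕ mass gap ∕ Clay.  Unit `pub-ymgap-dag-n06-w4` (g4), 2026-08-28.
-/

noncomputable section

namespace Literature.MathematicalPhysics.QuantumFieldTheory.Balaban1983to89.B9Thm311PlaqClosedReadingsCubeZd

open Filter Topology
open B7Prop1Explicit
open B7Prop1Local (PlaqIn pdevOn pdevOn_nonneg)
open B7Prop2Explicit (unitaryUnits)
open B8Ineq132 (plaqF)
open B8Eq131Cubes (sqLo sqHi)
open B8Eq131CubesAdmissible (cubeFam)
open B8CubeMemberZd (cubeLamS)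
open B8Ineq159FlatCubeMemberPrinted (cubeLamBP)
open B8LeafModelZd (ZdIdx)
open B9SupplySockB9P3ZdLetters (OpsZd deltaAOf)
open B9SupplySockB9P3ZdAllLettersZd (opsAllZd)
open B9Eq316AveragingTransposeZd (Reg17 alphaQ alphaQ_pos)
open B9Eq327GreenZd (domSub bondPair)
open B9Eq327GreenZdHerm (domSubH RegularAtH gopZdH)
open B9Thm311PosDefOpenZd (cubeMember_Ω0_finite)
open B9Thm311CoerciveCompactZd (exists_coercive_and_regularAtH_of_pdevOn_lt_cube)
open B9Thm33GreenL2BoundCubeZd (bondPair_gopZdH_self_le_of_coercive_of_mem)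
open B9Thm31CoercivePrimeCompactZd (reg17Univ_of_forall_plaqF_le one_mem_plaqClosed)

export B7Prop1Explicit (Site)

variable {d : ℕ} {𝔸 : Type*} [CStarAlgebra 𝔸]

/-! ## §1  From the closed class to the box deviation -/

/-- **plaquettes uniformly within `β` of `1` ⟹ `pdevOn lo hi U₀ ≤ β`** on every box (`pdevOn` is a supremum of the same plaquette norms over the box; `0 ≤ β` is read off
any plaquette when `0 < d`, and assumed otherwise). [cite: Balaban1985RegularSpaces, (1.7) p.77; Balaban1985Averaging, (44) p.24] -/
theorem pdevOn_le_of_forall_plaqF_le {β : ℝ} (hβ : 0 ≤ β) {U₀ : Site d → Fin d → 𝔸ˣ} (h : ∀ (x : Site d) (μ ν : Fin d), ‖plaqF U₀ μ ν x - 1‖ ≤ β)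
    (lo hi : Site d) : pdevOn lo hi U₀ ≤ β := by
  refine Real.iSup_le (fun p => ?_) hβ
  have := h p.1.1 p.1.2.1 p.1.2.2
  rwa [plaqF] at this

/-- the strict version: `β < α` ⟹ `pdevOn lo hi U₀ < α`. [cite: Balaban1985RegularSpaces, (1.7) p.77] -/
theorem pdevOn_lt_of_forall_plaqF_le {α β : ℝ} (hβ : 0 ≤ β) (hβα : β < α) {U₀ : Site d → Fin d → 𝔸ˣ}
    (h : ∀ (x : Site d) (μ ν : Fin d), ‖plaqF U₀ μ ν x - 1‖ ≤ β) (lo hi : Site d) : pdevOn lo hi U₀ < α :=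
  lt_of_le_of_lt (pdevOn_le_of_forall_plaqF_le hβ h lo hi) hβα

/-! ## §2  The package on the closed class at a cube member -/

section Cube

variable [FiniteDimensional ℝ 𝔸] [Nontrivial 𝔸] {L : ℕ}
variable (τ : 𝔸 →ₗ[ℂ] ℂ) (hτp : ∀ a : 𝔸, a ≠ 0 → 0 < (τ (star a * a)).re)
  (hτt : ∀ a b : 𝔸, τ (a * b) = τ (b * a)) (hτs : ∀ a : 𝔸, τ (star a) = starRingEnd ℂ (τ a))

include hτp hτt hτs in
/-- ★★★ **THE Δ_a ∕ G_𝔤 PACKAGE ON THE CLOSED CLASS (1.7) ON `ℤᵈ` AT ONE CUBE MEMBER**: `α > 0`, `c > 0` (member-dependent) such that for every `0 ≤ β < α` and every unitary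
`U₀` with `‖U₀(∂p) − 1‖ ≤ β` at EVERY plaquette of `ℤᵈ`: (a) `c·⟨A, A⟩_τ ≤ ⟨A, Δ_a(U₀)A⟩_τ` on `E_𝔤(□₀)`, (b) `Δ_a(U₀)↾□₀` invertible on `E_𝔤(□₀)` (`G_𝔤(U₀)` exists),
(c) `⟨G_𝔤(U₀)J, G_𝔤(U₀)J⟩_τ ≤ c⁻²·⟨J, J⟩_τ` for every Hermitian `J ∈ E(□₀)`, (d) `U₀` in the member's class (1.7) at window `α_Q∕L²` — the genuine four-letter `Δ_a` of `opsAllZd` at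
print's class `cubeLamBP` (`Ω = cubeFam false …`, `Λs = cubeLamS …`, `m ≤ k`, `2 ≤ d`, `2 ≤ L ≤ ρ`).
[cite: Balaban1985BackgroundPropagators, Thm 3.11 p.416, Thm 3.3 p.399, (3.27) p.395, (3.35) p.396; Balaban1984PropagatorsII, p.226, (2.22); Balaban1985RegularSpaces, (1.7) p.77, (1.131) p.99] -/
theorem exists_package_plaqClosed_cube (hd2 : 2 ≤ d) (hL : 2 ≤ L) (ops₀ : ℝ → ZdIdx d L → ℕ → OpsZd d 𝔸) (M : ℝ) (i : ZdIdx d L)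
    {a : Site d} {Mc ρ : ℕ} (hρ : L ≤ ρ) (hΩ : i.Ω = cubeFam false L a Mc ρ i.k) (hΛs : i.Λs = cubeLamS L a Mc ρ i.k) {m : ℕ} (hm : m ≤ i.k) :
    ∃ α : ℝ, 0 < α ∧ ∃ c : ℝ, 0 < c ∧ ∀ β : ℝ, 0 ≤ β → β < α → ∀ U₀ : Site d → Fin d → 𝔸ˣ, (∀ x κ, U₀ x κ ∈ unitaryUnits 𝔸) →
      (∀ (x : Site d) (μ ν : Fin d), ‖plaqF U₀ μ ν x - 1‖ ≤ β) →
        (∀ A ∈ domSubH (𝔸 := 𝔸) (i.Ω 0),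
            c * bondPair τ A A ≤ bondPair τ A (deltaAOf i.η (opsAllZd τ L (cubeLamBP L a Mc ρ i.k) ops₀ M i m) U₀ A)) ∧
          RegularAtH i.η (opsAllZd τ L (cubeLamBP L a Mc ρ i.k) ops₀ M i m) (i.Ω 0) U₀ ∧
          (∀ J ∈ domSubH (𝔸 := 𝔸) (i.Ω 0),
            bondPair τ (gopZdH i.η (opsAllZd τ L (cubeLamBP L a Mc ρ i.k) ops₀ M i m) (i.Ω 0) U₀ J)
                (gopZdH i.η (opsAllZd τ L (cubeLamBP L a Mc ρ i.k) ops₀ M i m) (i.Ω 0) U₀ J) ≤ c⁻¹ ^ 2 * bondPair τ J J) ∧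
          Reg17 L m i.Ω (alphaQ d L / (L : ℝ) ^ 2) U₀ := by
  have hfin : (i.Ω 0).Finite := cubeMember_Ω0_finite i hΩ
  obtain ⟨α, hα, c, hc, h⟩ := exists_coercive_and_regularAtH_of_pdevOn_lt_cube τ hτp hτt hτs hd2 hL ops₀ M i hρ hΩ hΛs hm
  refine ⟨α, hα, c, hc, fun β hβ hβα U₀ hU₀ hplaq => ?_⟩
  obtain ⟨hcoer, hreg, h17⟩ := h U₀ hU₀ (pdevOn_lt_of_forall_plaqF_le hβ hβα hplaq _ _)
  exact ⟨hcoer, hreg, fun J hJ => bondPair_gopZdH_self_le_of_coercive_of_mem τ hτp hτs i.η _ (i.Ω 0) U₀ hfin hreg hc hcoer hJ, h17⟩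

include hτp hτt hτs in
/-- ★★ **THE SAME WITH THE REGIME MEMBERSHIP ON ALL OF `ℤᵈ`** (the class of the Combes–Thomas stations and of `B9Thm31CoercivePrimeCompactZd` ∕ `B9Eq325QGGQCoerciveCompactZd`):
shrinking `α` below `(α_Q∕L²)·L^{−2m}`, every unitary `U₀` with all plaquettes `≤ β < α` satisfies (a)–(c) AND lies in `𝒰′ = {unitary ∧ (1.7) on ℤᵈ at window α_Q∕L²}`.
[cite: Balaban1985BackgroundPropagators, Thm 3.11 p.416, (3.35) p.396; Balaban1985RegularSpaces, (1.7) p.77] -/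
theorem exists_package_plaqClosed_reg17Univ_cube (hd2 : 2 ≤ d) (hL : 2 ≤ L) (ops₀ : ℝ → ZdIdx d L → ℕ → OpsZd d 𝔸) (M : ℝ) (i : ZdIdx d L)
    {a : Site d} {Mc ρ : ℕ} (hρ : L ≤ ρ) (hΩ : i.Ω = cubeFam false L a Mc ρ i.k) (hΛs : i.Λs = cubeLamS L a Mc ρ i.k) {m : ℕ} (hm : m ≤ i.k) :
    ∃ α : ℝ, 0 < α ∧ ∃ c : ℝ, 0 < c ∧ ∀ β : ℝ, 0 ≤ β → β < α → ∀ U₀ : Site d → Fin d → 𝔸ˣ, (∀ x κ, U₀ x κ ∈ unitaryUnits 𝔸) →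
      (∀ (x : Site d) (μ ν : Fin d), ‖plaqF U₀ μ ν x - 1‖ ≤ β) →
        (∀ A ∈ domSubH (𝔸 := 𝔸) (i.Ω 0),
            c * bondPair τ A A ≤ bondPair τ A (deltaAOf i.η (opsAllZd τ L (cubeLamBP L a Mc ρ i.k) ops₀ M i m) U₀ A)) ∧
          RegularAtH i.η (opsAllZd τ L (cubeLamBP L a Mc ρ i.k) ops₀ M i m) (i.Ω 0) U₀ ∧
          (∀ J ∈ domSubH (𝔸 := 𝔸) (i.Ω 0),
            bondPair τ (gopZdH i.η (opsAllZd τ L (cubeLamBP L a Mc ρ i.k) ops₀ M i m) (i.Ω 0) U₀ J)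
                (gopZdH i.η (opsAllZd τ L (cubeLamBP L a Mc ρ i.k) ops₀ M i m) (i.Ω 0) U₀ J) ≤ c⁻¹ ^ 2 * bondPair τ J J) ∧
          U₀ ∈ {U₀ : Site d → Fin d → 𝔸ˣ | (∀ x κ, U₀ x κ ∈ unitaryUnits 𝔸) ∧
            Reg17 L m (fun _ => (Set.univ : Set (Site d))) (alphaQ d L / (L : ℝ) ^ 2) U₀} := by
  have hL1 : 1 ≤ L := le_trans one_le_two hL
  have hL0 : (0 : ℝ) < L := by exact_mod_cast (lt_of_lt_of_le zero_lt_one hL1)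
  have hw : (0 : ℝ) < alphaQ d L / (L : ℝ) ^ 2 * (((L : ℝ) ^ m)⁻¹) ^ 2 := by
    have := alphaQ_pos d hL1
    positivity
  obtain ⟨α, hα, c, hc, h⟩ := exists_package_plaqClosed_cube τ hτp hτt hτs hd2 hL ops₀ M i hρ hΩ hΛs hm
  refine ⟨min α (alphaQ d L / (L : ℝ) ^ 2 * (((L : ℝ) ^ m)⁻¹) ^ 2), lt_min hα hw, c, hc, fun β hβ hβα U₀ hU₀ hplaq => ?_⟩
  obtain ⟨h1, h2, h3, -⟩ := h β hβ (lt_of_lt_of_le hβα (min_le_left _ _)) U₀ hU₀ hplaq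
  exact ⟨h1, h2, h3, hU₀, reg17Univ_of_forall_plaqF_le hL1 m (lt_of_lt_of_le hβα (min_le_right _ _)) hplaq⟩

include hτp hτt hτs in
/-- **A6 ∕ NON-VACUITY**: the flat background is in the closed class with `β = 0`, and the package holds there with the member's constants.
[cite: Balaban1985BackgroundPropagators, Thm 3.11 p.416 («G_□(1) is positive»); Balaban1984PropagatorsII, (2.11) p.225] -/
theorem package_one_cube (hd2 : 2 ≤ d) (hL : 2 ≤ L) (ops₀ : ℝ → ZdIdx d L → ℕ → OpsZd d 𝔸) (M : ℝ) (i : ZdIdx d L)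
    {a : Site d} {Mc ρ : ℕ} (hρ : L ≤ ρ) (hΩ : i.Ω = cubeFam false L a Mc ρ i.k) (hΛs : i.Λs = cubeLamS L a Mc ρ i.k) {m : ℕ} (hm : m ≤ i.k) :
    ∃ c : ℝ, 0 < c ∧
      (∀ A ∈ domSubH (𝔸 := 𝔸) (i.Ω 0),
          c * bondPair τ A A ≤ bondPair τ A (deltaAOf i.η (opsAllZd τ L (cubeLamBP L a Mc ρ i.k) ops₀ M i m) 1 A)) ∧
        RegularAtH i.η (opsAllZd τ L (cubeLamBP L a Mc ρ i.k) ops₀ M i m) (i.Ω 0) 1 ∧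
        (∀ J ∈ domSubH (𝔸 := 𝔸) (i.Ω 0),
          bondPair τ (gopZdH i.η (opsAllZd τ L (cubeLamBP L a Mc ρ i.k) ops₀ M i m) (i.Ω 0) 1 J)
              (gopZdH i.η (opsAllZd τ L (cubeLamBP L a Mc ρ i.k) ops₀ M i m) (i.Ω 0) 1 J) ≤ c⁻¹ ^ 2 * bondPair τ J J) := by
  obtain ⟨α, hα, c, hc, h⟩ := exists_package_plaqClosed_cube τ hτp hτt hτs hd2 hL ops₀ M i hρ hΩ hΛs hm
  have h1 := one_mem_plaqClosed (d := d) (𝔸 := 𝔸) (β := 0) le_rfl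
  obtain ⟨ha, hb, hc', -⟩ := h 0 le_rfl hα 1 h1.1 h1.2
  exact ⟨c, hc, ha, hb, hc'⟩

end Cube

end Literature.MathematicalPhysics.QuantumFieldTheory.Balaban1983to89.B9Thm311PlaqClosedReadingsCubeZd

end
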